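import Summits.RiemannHypothesis.RiemannHypothesis.Theorems.GroundBartaEvenWinsBeyondArchDeflationM83Common
import HarnessLib

/-!
# RiemannHypothesis / GroundBarta — parity ladder beyond `83/100` (`EvenWinsBeyondArch`, stmt-RiemannHypothesis-18085):
# shared kernel checks of the A-layer at the window `b = 91/100` (right end of parity cell 9, `{2,3,4,5}`-window)

Helper file (`--supports stmt-RiemannHypothesis-18085`), RH-free, no named facts.  Prover A (gen 21 of unit `sr-gb-rung-a`),
after the per-cell `…Common` template of the earlier cells (`…M78Common`, `…M83Common`).

The window `b = 91/100` is the right end of parity cell 9 `(173/200, 91/100]` (A g21, HOME(A)/LADDER-CELLS-9-11-A-g21.md after prover B g8's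
placement scan HOME(B)/CELL8-SCAN.md: `ε_ev(0.91) ≈ 1.36·10⁻²³`, `ε_od(0.91) ≈ 2.0·10⁻²⁰` (n = 32 Ritz); `0.92` is not reachable from `U(173/200) = 7.05·10⁻²¹`);
on it the prime powers `2, 3, 4, 5` are visible (`e^{1.82} = 6.17 < 7`).  The pieces of the A-layer certificates that depend only on the window:
`(log 5)/2 < 91/100 ≤ (log 7)/2` (`m91_log5half_lt`, `m91_le_log7half`), the pole check at scale `2⁵⁰⁰`
(`m91_poleCheck500`); the killing-constant bracket at `91/100` (`m91_markov_mem`, from the sharp `dt_fp_weilMarkovConstant_sharp4`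
of `…MarkovY4`) lives in `…Upper91Sharp`, its only user, so that this file does not wait for `…MarkovY4`'s build.  The `1/√5` bracket `m83_i5lo/m83_i5hi` and the four-prime-power prime check `m83_primeCheck` are
window-independent and are reused from `…M83Common`.
-/

set_option linter.dupNamespace false

noncomputable section

namespace Summit.RiemannHypothesis.RiemannHypothesis.Theorems.EvenWinsBeyondArch

open Literature.NumberTheory.LFunctions

/-- `(log 5)/2 < 91/100` (`log 5 = 2 log 2 + log (5/4) ≤ 2·0.6931471808 + 1/4`). [folklore] -/
theorem m91_log5half_lt : Real.log 5 / 2 < (((91 / 100 : ℚ)) : ℝ) := by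
  have h2 := Real.log_two_lt_d9
  have h4 : Real.log 4 = 2 * Real.log 2 := by
    rw [show (4 : ℝ) = 2 ^ 2 by norm_num, Real.log_pow]; norm_num
  have h54 : Real.log (5 / 4) ≤ 5 / 4 - 1 := Real.log_le_sub_one_of_pos (by norm_num)
  have h5 : Real.log 5 = Real.log 4 + Real.log (5 / 4) := by
    rw [← Real.log_mul (by norm_num) (by norm_num)]; norm_num
  push_cast
  rw [h5, h4]
  norm_num at h2 h54 ⊢
  linarith

/-- `91/100 ≤ (log 7)/2` (`log 7 = 3 log 2 − log (8/7) ≥ 3·0.6931471805 − 1/7`). [folklore] -/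
theorem m91_le_log7half : (((91 / 100 : ℚ)) : ℝ) ≤ Real.log 7 / 2 := by
  have h2 := Real.log_two_gt_d9
  have h8 : Real.log 8 = 3 * Real.log 2 := by
    rw [show (8 : ℝ) = 2 ^ 3 by norm_num, Real.log_pow]; norm_num
  have h87 : Real.log (8 / 7) ≤ 8 / 7 - 1 := Real.log_le_sub_one_of_pos (by norm_num)
  have h7 : Real.log 7 = Real.log 8 - Real.log (8 / 7) := by
    rw [← Real.log_div (by norm_num) (by norm_num)]; norm_num
  push_cast
  rw [h7, h8]
  norm_num at h2 h87 ⊢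
  linarith

/-- `83/100 ≤ 91/100` as real casts of the rational windows (for the antitone transport of U-sides). [folklore] -/
theorem m91_ge_83 : (((83 / 100 : ℚ)) : ℝ) ≤ (((91 / 100 : ℚ)) : ℝ) := by
  push_cast; norm_num

set_option maxHeartbeats 0 in
/-- The pole check at `b = 91/100` at scale `2⁵⁰⁰` (`Ke = 64`), shared by the per-vector finals. [folklore] -/
theorem m91_poleCheck500 : poleCheckY (2 ^ 500) 64 4 (91 / 100) = true := by decide +kernel

end Summit.RiemannHypothesis.RiemannHypothesis.Theorems.EvenWinsBeyondArch

end
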